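import Summits.BirchSwinnertonDyer.BirchSwinnertonDyer.Theorems.ByReductionTypeAtTwoRankOneAtTwoOffBigImageOddLocalImageCellDefs
import HarnessLib

/-!
# Route `ByReductionTypeAtTwo`, crux `RankOneAtTwoOffBigImageOddLocal` (stmt-BirchSwinnertonDyer-23716), line
# `refined_kolyvagin_tamagawa_shift_at_two`: the DEEP witness currency of the re-cut skeleton (g13) — Kolyvagin's conjecture at `2` in
# infinite-supply form, and the structure statements with the stringent-primitivity witness ONE LEVEL ABOVE `M₀`, on REGULAR primes over δ

Lead prover `prover-cruxlead-stmt-BirchSwinnertonDyer-23716-g6` (2026-08-28).  Third statement module of the line (after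
`…OffBigImageOddLocalDefs.lean`, p643983, and `…OffBigImageOddLocalImageCellDefs.lean`, p662501; both at or near the 400-line cap).  The pen's
ruling RC-343 (bsd-2adic-plan GEN 29, 2026-08-28T22:32Z) on the lead's memo `Cruxes/RankOneAtTwoOffBigImageOddLocal/FirstRungAtTwo.md` and its
kernel companion `…OffBigImageOddLocalFirstRungAtTwo.lean` (p673379) APPROVES the re-cut R1 + R2 of the K-side witness currency: at `p = 2` the
first rung of McCallum's ladder (Thm. 5.4) is formally undetermined at a Kolyvagin prime of level `≤ M₀` that is not generic for `y_K` (the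
opposite eigenspace of the Mordell–Weil line mod `2^M` is `{0, η}`, not `0`), and on `Δ > 0` every NON-REGULAR Kolyvagin prime is non-generic —
so the stringent-primitivity witness the mechanism can consume is one at level `M(n₀) ≥ max(σ + 1, M₀ + 1)` (R1) on REGULAR primes over the
full-image cell (R2).  This module states, as closed importable declarations over the first two modules' vocabulary:

* `RegularOnFullImageAtTwo` — the witness filter of the re-cut: `RegularAtTwo W ℓ` on the full-`2`-adic-image cell δ, no condition off it
  (on γ₂ the numerical primes stay; regular involutions of every level exist on δ, none above level `2` on γ₂c);
* `StringentPrimitivityModTwoDeepWith Φ` — S4′(∞): Kolyvagin's conjecture at `2` in INFINITE-SUPPLY form — for EVERY level `L` some square-free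
  product `n` of Kolyvagin primes at `2`, each a `Φ`-prime, with `M(n) ≥ L`, carries a derived point `P(n)` NOT `2^{σ+1}`-divisible (depth `≤ σ` at
  every level; `L := σ + 1` is the registered S4′(Φ) `StringentPrimitivityModTwoWith Φ`); and its cell form `StringentPrimitivityModTwoDeepWithOn Φ Ω`;
* `ShiftedKolyvaginStructureModTwoDeepWithOn Φ Ω` — S5″(Φ, Ω) with the witness taken ALSO at level `M(n) ≥ M₀ + 1` (one extra binder line; every
  other character identical to `ShiftedKolyvaginStructureModTwoWithOn Φ Ω`), hence WEAKER than it;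
* `ShiftedKolyvaginStructureModTwoDeepWithOnPos Φ Ω` — the same with the `0 < σ(W, Dt)` binder of `…WithOnPos` (the lead's stub on δ⁺).

Statements only (the line's re-cut stub signatures — to be proved / refuted / reshaped; nothing is asserted; locators in plain text so that no
stub signature is relocated to `Literature/`).  BSD is not proved by any of this; the crux is not proved; every statement here is OPEN mathematics
at `p = 2` (McCallum 1991 §5 is `p` odd; W. Zhang 2014 is `p ≥ 5`; Burungale–Castella–Grossi–Skinner 2023 is `p > 3`).

References (locators): McCallum, LMS LNS 153 (1991) §1 Theorem (p. 296), §5 Lemma 5.1, Thm. 5.4, Cor. 5.6; Kolyvagin, *Euler systems* (1990)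
Thm. A and the `2^{n+m}`-level device of Thm. B₂; Gross, LMS LNS 153 (1991) Prop. 5.4 (ii), Prop. 6.2; W. Zhang, Camb. J. Math. 2 (2014)
Notations (xii), §3.7; Jetchev 2008 (1.3).
-/

set_option linter.dupNamespace false -- tree convention: `Summit.BirchSwinnertonDyer.BirchSwinnertonDyer.Theorems` (summit = sub-problem)
set_option autoImplicit false

noncomputable section

open scoped Classical

namespace Summit.BirchSwinnertonDyer.BirchSwinnertonDyer.Theorems.OffBigImageOddLocalAtTwo

open WeierstrassCurve NumberField Literature.NumberTheory.EllipticCurves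
  Literature.NumberTheory.EllipticCurves.ModularForms

/-- **The re-cut's witness filter Φδ (RC-343, R2): REGULAR on the full-`2`-adic-image cell, unrestricted off it.**  `RegularAtTwo W ℓ` (`Δ_W` a
non-square mod `ℓ`: `Frob_ℓ` is a transposition on `E[2] ∖ 0`) whenever `ρ_{W,2^n}` is onto for every `n`; no condition on the γ₂ cell (mod-`2` onto,
`2`-adic image not onto), where the numerical primes stay.  On δ with `Δ > 0` every NON-regular Kolyvagin prime is non-generic for `y_K`
(`y_K ∈ 2^{M₀+1} E(K_λ)`; memo `FirstRungAtTwo.md` §4), so this filter is a NECESSARY condition for the first rung of McCallum's mechanism there;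
regular Kolyvagin primes of every level exist on δ (the line's engine, `Engine.exists_regular_kolyvaginPrime_of_heegner`). (McCallumLMS1991, §5) -/
def RegularOnFullImageAtTwo (W : WeierstrassCurve ℚ) (ℓ : ℕ) : Prop :=
  OnFullImageCell W → RegularAtTwo W ℓ

/-- **S4′(∞, Φ) `StringentPrimitivityModTwoDeepWith Φ` — Kolyvagin's conjecture at `2` with the Tamagawa shift, INFINITE-SUPPLY form (RC-343, R1):**
same habitat as `StringentPrimitivityModTwoWith Φ` (`W` globally minimal non-CM, `ρ̄_{W,2}` onto, analytic rank `1`; `K` Kolyvagin-admissible at `2`;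
ANY datum `Dt`, `β`, `ι`, conductor-`1` datum `d₁` with `y_K = P(1)` of infinite order); for EVERY level `L : ℕ`, SOME square-free product `n` of
Kolyvagin primes at `2`, each satisfying `Φ W ℓ`, with `M(n) ≥ L`, carries a conductor-`n` datum whose derived point `P(n)` is NOT
`2^{σ(W,Dt)+1}`-divisible in `E(K[n])` — depth `≤ σ` witnessed at EVERY level (the refined conjecture `M_∞ = σ` read on Kolyvagin's `Λ_L` for all
`L`).  `L := σ + 1` gives the registered `StringentPrimitivityModTwoWith Φ`; the re-cut skeleton registers the instance `Φ = RegularOnFullImageAtTwo`.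
OPEN at `p = 2`. (WZhang2014, §3.7) (McCallumLMS1991, §5 Lemma 5.1) -/
def StringentPrimitivityModTwoDeepWith (Φ : WeierstrassCurve ℚ → ℕ → Prop) : Prop :=
  ∀ (W : WeierstrassCurve ℚ) [W.IsElliptic] [W.IsGloballyMinimal] [NeZero (W.conductorNorm ℤ)],
    ¬ W.HasCM → W.HasSurjectiveModNGaloisRep 2 → W.analyticRank = 1 →
    ∀ (K : Type) [Field K] [NumberField K], IsImaginaryQuadratic K → Odd (NumberField.discr K) →
      NumberField.discr K ≠ -3 → SatisfiesHeegnerHypothesis (W.conductorNorm ℤ) K →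
      ¬ IsSquare ((NumberField.discr K : ℚ) * -|W.Δ|) → ¬ IsSquare ((NumberField.discr K : ℚ) * (-(2 * |W.Δ|))) →
      ∀ (Dt : ModularParametrizationData W (W.conductorNorm ℤ)) (β : ℤ) (ι : K →+* ℂ) (d₁ : KolyvaginHeegnerData Dt β ι 1),
        ¬ IsOfFinAddOrder d₁.derivedPoint →
        ∀ (L : ℕ), ∃ (n : ℕ) (d : KolyvaginHeegnerData Dt β ι n), Squarefree n ∧
          (∀ ℓ ∈ n.primeFactors, Zhang2014.IsKolyvaginPrime (W.conductorNorm ℤ) W K 2 ℓ ∧ Φ W ℓ) ∧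
          ((L : ℕ) : ℕ∞) ≤ Zhang2014.levelIndex W 2 n ∧
          ¬ ∃ Q : (W.baseChange (ringClassField K ι n)).toAffine.Point,
            ((2 ^ (sigmaShift W Dt + 1) : ℕ) : ℤ) • Q = d.derivedPoint

/-- **S4″(∞, Φ, Ω) `StringentPrimitivityModTwoDeepWithOn Φ Ω` — the infinite-supply form ON THE CELL `Ω`** (`StringentPrimitivityModTwoDeepWith Φ` with
the binder `Ω W` after the habitat binder; `Ω = ⊤` recovers the cell-free form; monotone in both slots).  The shape the atlas glue consumes.
(WZhang2014, §3.7) -/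
def StringentPrimitivityModTwoDeepWithOn (Φ : WeierstrassCurve ℚ → ℕ → Prop) (Ω : WeierstrassCurve ℚ → Prop) : Prop :=
  ∀ (W : WeierstrassCurve ℚ) [W.IsElliptic] [W.IsGloballyMinimal] [NeZero (W.conductorNorm ℤ)],
    ¬ W.HasCM → W.HasSurjectiveModNGaloisRep 2 → Ω W → W.analyticRank = 1 →
    ∀ (K : Type) [Field K] [NumberField K], IsImaginaryQuadratic K → Odd (NumberField.discr K) →
      NumberField.discr K ≠ -3 → SatisfiesHeegnerHypothesis (W.conductorNorm ℤ) K →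
      ¬ IsSquare ((NumberField.discr K : ℚ) * -|W.Δ|) → ¬ IsSquare ((NumberField.discr K : ℚ) * (-(2 * |W.Δ|))) →
      ∀ (Dt : ModularParametrizationData W (W.conductorNorm ℤ)) (β : ℤ) (ι : K →+* ℂ) (d₁ : KolyvaginHeegnerData Dt β ι 1),
        ¬ IsOfFinAddOrder d₁.derivedPoint →
        ∀ (L : ℕ), ∃ (n : ℕ) (d : KolyvaginHeegnerData Dt β ι n), Squarefree n ∧
          (∀ ℓ ∈ n.primeFactors, Zhang2014.IsKolyvaginPrime (W.conductorNorm ℤ) W K 2 ℓ ∧ Φ W ℓ) ∧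
          ((L : ℕ) : ℕ∞) ≤ Zhang2014.levelIndex W 2 n ∧
          ¬ ∃ Q : (W.baseChange (ringClassField K ι n)).toAffine.Point,
            ((2 ^ (sigmaShift W Dt + 1) : ℕ) : ℤ) • Q = d.derivedPoint

/-- **S5″(deep, Φ, Ω) `ShiftedKolyvaginStructureModTwoDeepWithOn Φ Ω` — McCallum's structure theorem at `2` with the shift, on the cell `Ω` with
witness filter `Φ`, the stringent-primitivity witness taken ONE LEVEL ABOVE `M₀` AS WELL (RC-343, R1):** `ShiftedKolyvaginStructureModTwoWithOn Φ Ω`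
character for character, with ONE extra binder line `((M₀ + 1 : ℕ) : ℕ∞) ≤ M(n)` next to the registered `((σ + 1 : ℕ) : ℕ∞) ≤ M(n)` — i.e. the
witness level is `≥ max(σ + 1, M₀ + 1)` — so this statement is WEAKER than `…WithOn Φ Ω` (more hypotheses on the witness).  For `W` non-CM with
`ρ̄_{W,2}` onto in `Ω`, a Kolyvagin-admissible `K`, any datum, `2^{M₀} ∥ P(1)`: K1-shape (every `P(n)` is `2^{min(σ, M(n))}`-divisible) ∧ a K2-witness
`P(n)` on `Φ`-primes with `M(n) ≥ σ + 1`, `M(n) ≥ M₀ + 1`, NOT `2^{σ+1}`-divisible ⟹ `#Ш(E/K)[2^∞] = 2^{2(M₀ − σ)}`.  Why `M₀ + 1`: at level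
`M > M₀` the class `2^{M−M₀} c_M(ℓ) ∈ Sel(E/K)^{−ε}` meets the Mordell–Weil line in `{0, [2^{M−1} g]}` and is separated from `[2^{M−1} g]` by its
vanishing at `λ` (Kolyvagin relation at `2`, GK2 item 24880), whatever the prime; at level `≤ M₀` this separation needs a `y_K`-generic prime
(memo `FirstRungAtTwo.md` §2–§3).  OPEN at `p = 2`. (McCallumLMS1991, §5 Thm. 5.4) -/
def ShiftedKolyvaginStructureModTwoDeepWithOn (Φ : WeierstrassCurve ℚ → ℕ → Prop) (Ω : WeierstrassCurve ℚ → Prop) : Prop :=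
  ∀ (W : WeierstrassCurve ℚ) [W.IsElliptic] [W.IsGloballyMinimal] [NeZero (W.conductorNorm ℤ)],
    ¬ W.HasCM → W.HasSurjectiveModNGaloisRep 2 → Ω W →
    ∀ (K : Type) [Field K] [NumberField K], IsImaginaryQuadratic K → Odd (NumberField.discr K) →
      NumberField.discr K ≠ -3 → SatisfiesHeegnerHypothesis (W.conductorNorm ℤ) K →
      ¬ IsSquare ((NumberField.discr K : ℚ) * -|W.Δ|) → ¬ IsSquare ((NumberField.discr K : ℚ) * (-(2 * |W.Δ|))) →
      ∀ (Dt : ModularParametrizationData W (W.conductorNorm ℤ)) (β : ℤ) (ι : K →+* ℂ) (d₁ : KolyvaginHeegnerData Dt β ι 1),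
        ¬ IsOfFinAddOrder d₁.derivedPoint →
        ∀ (M₀ : ℕ), (∃ Q : (W.baseChange (ringClassField K ι 1)).toAffine.Point, ((2 ^ M₀ : ℕ) : ℤ) • Q = d₁.derivedPoint) →
          (¬ ∃ Q : (W.baseChange (ringClassField K ι 1)).toAffine.Point, ((2 ^ (M₀ + 1) : ℕ) : ℤ) • Q = d₁.derivedPoint) →
          (∀ (n : ℕ) (d : KolyvaginHeegnerData Dt β ι n) (m : ℕ), Squarefree n →
              (∀ ℓ ∈ n.primeFactors, Zhang2014.IsKolyvaginPrime (W.conductorNorm ℤ) W K 2 ℓ) →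
              (m : ℕ∞) ≤ Zhang2014.levelIndex W 2 n → m ≤ sigmaShift W Dt →
              ∃ Q : (W.baseChange (ringClassField K ι n)).toAffine.Point, ((2 ^ m : ℕ) : ℤ) • Q = d.derivedPoint) →
          ∀ (n : ℕ) (d : KolyvaginHeegnerData Dt β ι n), Squarefree n →
            (∀ ℓ ∈ n.primeFactors, Zhang2014.IsKolyvaginPrime (W.conductorNorm ℤ) W K 2 ℓ ∧ Φ W ℓ) →
            ((sigmaShift W Dt + 1 : ℕ) : ℕ∞) ≤ Zhang2014.levelIndex W 2 n →
            ((M₀ + 1 : ℕ) : ℕ∞) ≤ Zhang2014.levelIndex W 2 n →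
            (¬ ∃ Q : (W.baseChange (ringClassField K ι n)).toAffine.Point,
              ((2 ^ (sigmaShift W Dt + 1) : ℕ) : ℤ) • Q = d.derivedPoint) →
            Nat.card (AddCommGroup.primaryComponent (W.baseChange K).sha 2) = 2 ^ (2 * (M₀ - sigmaShift W Dt))

/-- **S5⁺(deep, Φ, Ω) `ShiftedKolyvaginStructureModTwoDeepWithOnPos Φ Ω` — the same on POSITIVE SHIFT ONLY** (`ShiftedKolyvaginStructureModTwoWithOnPos Φ Ω`
with the one extra witness line `((M₀ + 1 : ℕ) : ℕ∞) ≤ M(n)`; WEAKER than it).  The re-cut skeleton registers the instance `Φ = RegularOnFullImageAtTwo`,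
`Ω = OnDeltaPlusCell` (full `2`-adic image, `Δ > 0`, `σ ≥ 1`) as the lead's stub `stub_sigmaShiftPosDisc`: McCallum's Thm. 5.4 at `2` with `M_∞ = σ ≥ 1`
where complex conjugation fixes `E[2]`, from a K2 witness on REGULAR primes at level `≥ max(σ+1, M₀+1)`.  By `FirstRung.…_of_halves_allowance` (p673379,
one-token variant) each of its two halves may lose one bit.  OPEN (nothing in print at `2`). (McCallumLMS1991, §5 Thm. 5.4) -/
def ShiftedKolyvaginStructureModTwoDeepWithOnPos (Φ : WeierstrassCurve ℚ → ℕ → Prop) (Ω : WeierstrassCurve ℚ → Prop) : Prop :=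
  ∀ (W : WeierstrassCurve ℚ) [W.IsElliptic] [W.IsGloballyMinimal] [NeZero (W.conductorNorm ℤ)],
    ¬ W.HasCM → W.HasSurjectiveModNGaloisRep 2 → Ω W →
    ∀ (K : Type) [Field K] [NumberField K], IsImaginaryQuadratic K → Odd (NumberField.discr K) →
      NumberField.discr K ≠ -3 → SatisfiesHeegnerHypothesis (W.conductorNorm ℤ) K →
      ¬ IsSquare ((NumberField.discr K : ℚ) * -|W.Δ|) → ¬ IsSquare ((NumberField.discr K : ℚ) * (-(2 * |W.Δ|))) →
      ∀ (Dt : ModularParametrizationData W (W.conductorNorm ℤ)) (β : ℤ) (ι : K →+* ℂ) (d₁ : KolyvaginHeegnerData Dt β ι 1),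
        ¬ IsOfFinAddOrder d₁.derivedPoint → 0 < sigmaShift W Dt →
        ∀ (M₀ : ℕ), (∃ Q : (W.baseChange (ringClassField K ι 1)).toAffine.Point, ((2 ^ M₀ : ℕ) : ℤ) • Q = d₁.derivedPoint) →
          (¬ ∃ Q : (W.baseChange (ringClassField K ι 1)).toAffine.Point, ((2 ^ (M₀ + 1) : ℕ) : ℤ) • Q = d₁.derivedPoint) →
          (∀ (n : ℕ) (d : KolyvaginHeegnerData Dt β ι n) (m : ℕ), Squarefree n →
              (∀ ℓ ∈ n.primeFactors, Zhang2014.IsKolyvaginPrime (W.conductorNorm ℤ) W K 2 ℓ) →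
              (m : ℕ∞) ≤ Zhang2014.levelIndex W 2 n → m ≤ sigmaShift W Dt →
              ∃ Q : (W.baseChange (ringClassField K ι n)).toAffine.Point, ((2 ^ m : ℕ) : ℤ) • Q = d.derivedPoint) →
          ∀ (n : ℕ) (d : KolyvaginHeegnerData Dt β ι n), Squarefree n →
            (∀ ℓ ∈ n.primeFactors, Zhang2014.IsKolyvaginPrime (W.conductorNorm ℤ) W K 2 ℓ ∧ Φ W ℓ) →
            ((sigmaShift W Dt + 1 : ℕ) : ℕ∞) ≤ Zhang2014.levelIndex W 2 n →
            ((M₀ + 1 : ℕ) : ℕ∞) ≤ Zhang2014.levelIndex W 2 n →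
            (¬ ∃ Q : (W.baseChange (ringClassField K ι n)).toAffine.Point,
              ((2 ^ (sigmaShift W Dt + 1) : ℕ) : ℤ) • Q = d.derivedPoint) →
            Nat.card (AddCommGroup.primaryComponent (W.baseChange K).sha 2) = 2 ^ (2 * (M₀ - sigmaShift W Dt))

end Summit.BirchSwinnertonDyer.BirchSwinnertonDyer.Theorems.OffBigImageOddLocalAtTwo

end
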